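import Literature.IUT.HodgeArakelov.MonoThetaProjectiveNaturalSystem
import Literature.IUT.HodgeArakelov.MonoThetaProjectiveModelSystem

/-!
# [IUTchII] Prop. 1.5 (i)/(ii) at the genuine models: proof-only companion of the two natural-system files
# (bridge B8, parts 5c/7; abc-iut cell, layer L6, node IUTchII:Prop1.5(i),(ii); seat abc-iut-w4-d038)

S. Mochizuki, *Inter-universal Teichmüller theory II*, kurims manuscript (Dec. 2020), §1, Prop. 1.5, p. 29
[claim: Mochizuki2012, status: disputed] (IUTchII §1 Prop 1.5, kurims p.29): "(i) … Such a projective system is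
uniquely determined, up to isomorphism, by `X̲̲_k` [cf. Remark 1.5.1 below; the discrete rigidity property of
[EtTh], Corollary 2.19, (ii)]. (ii) The transition morphisms of the resulting projective system of topological
groups `{… → Π_X(M^Θ_{M'}) → Π_X(M^Θ_M) → …}` … are all isomorphisms. Moreover, any isomorphism of topological
groups `Π_X(M^Θ_{M'}) ⥲ Π_X(M^Θ_M)`, where `M` divides `M'`, lifts to a morphism of mono-theta environments
`M^Θ_{M'} → M^Θ_M` [cf. [EtTh], Corollary 2.18, (iv)]."; S. Mochizuki, *The étale theta function …*, Publ. RIMS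
**45** (2009), Cor. 2.18 (i) p. 286 (PRIMS PDF p. 60) "there exists a functorial group-theoretic algorithm to
reconstruct the subquotients `Π^tp_Y, Π^tp_Ÿ, …`" [cite: MochizukiEtTh2009, Cor 2.18(i) p.60]; Cor. 2.19 (ii)
p. 290 (PDF p. 64) "any projective system … is isomorphic to the above natural projective system"
[cite: MochizukiEtTh2009, Cor 2.19(ii) p.64].

PROOF-ONLY companion (no definitions, no new named fact) of abc-iut-w4-d030's
`MonoThetaProjectiveModelSystem.lean` (p414139: `EtaleLevels.modelSystem`, `transitionsAreIsos_modelSystem`,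
`isMonoThetaCompatible_modelSystem`) and abc-iut-w5-d233's `MonoThetaProjectiveNaturalSystem.lean` (p414240:
`EtaleLevels.naturalSystem`, `transitionsAreIsos_naturalSystem(_of_cor218_i)`, `prop15_i_naturalSystem`), filed
per abc-iut-L6-lead §F v1.15 (4) and the node holder's GO (abc-iut-w4-d030, STATUS 2026-08-26T00:45:31Z (a)+(b)).

* `EtaleLevels.naturalSystem_eq_modelSystem` — the two landed encodings of the NATURAL projective system
  `… → 𝕄_{M'} → 𝕄_M → …` of model mono-theta environments of `X̲̲_K` over `ℕ_{≥1}` COINCIDE ON THE NOSE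
  (`rfl`: `ModelFamily.setting M = levelSetting M` definitionally, `setting_modelFamily`), so every theorem about
  either is a theorem about the other (MERGE-MAP: one object, two names).
* `EtaleLevels.isTopCharacteristic_PiY_of_cor218_i` — abc-iut-w4-d030's ad-hoc input of
  `transitionsAreIsos_modelSystem`, the topological characteristicity of `Π^tp_{Y̲̲} ⊆ Π^tp_{X̲̲}`
  (`IsTopCharacteristic`), READ OFF the named fact [EtTh] Cor. 2.18 (i) (`RigidData.Cor218_i`, first clause) for
  abc-iut-L2-t8's rigidity data of `X̲̲_K` at any one level.
* `EtaleLevels.transitionsAreIsos_modelSystem_of_cor218_i` — (b): **[IUTchII] Prop. 1.5 (ii) for the natural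
  system** in NAMED-FACT currency only: [EtTh] Cor. 2.18 (i) (level 1) + Cor. 2.18 (iv) first half
  (`ThetaEnvData.Cor218_iv_surjective`, every level).
* `EtaleLevels.prop15_i_modelSystem` — (a): **[IUTchII] Prop. 1.5 (i) in the PRINTED form** "uniquely determined,
  up to isomorphism, by `X̲̲_k`": every projective system of mono-theta environments over the model family of
  `X̲̲_K` whose transitions are morphisms of mono-theta environments (`IsMonoThetaCompatible`, abc-iut-L6-t19) is
  isomorphic (`Prop15_i`, abc-iut-L6-t1) to the natural system `modelSystem` — abc-iut-w4-d030's conditional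
  discharge of Prop. 1.5 (i)′ (`prop15_i'_etaleLevels`, p412881) at the pair `(modelSystem, B)` with the
  non-vacuity witness `isMonoThetaCompatible_modelSystem`. CONDITIONAL on exactly d030's named inputs
  (`IsSlimGroup D.PiTemp`, `IsOpenMap D.aug`, and at every level the [EtTh] Cor. 2.18 (iv) facts
  `Cor218_iv_surjective`, `Cor218_iv_fibre`).
* `EtaleLevels.prop15_i_modelSystem_symm` — the same with the natural system on the right.

HONEST FRAMING: bookkeeping/proofs over the cell's own [EtTh]-side objects; the [IUTchII] side is the claim key
`Mochizuki2012` (DISPUTED, D-0012); no side is taken on [IUTchIII] Cor. 3.12; typed ≠ discharged.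
-/

noncomputable section

namespace Literature.IUT.HodgeArakelov

open Literature.AnabelianGeometry.EtaleTheta Literature.AnabelianGeometry.SemiGraphs
open scoped Literature.AnabelianGeometry.EtaleTheta

namespace EtaleLevels

variable {p : ℕ} [Fact p.Prime] {D : Literature.AnabelianGeometry.EtaleTheta.ThetaSetting p}
  {E : D.EtaleThetaData} {l : ℕ} (C : E.DoubleUnderline l) (hC : D.Compat) (hS : D.Sec2Hyps)
  (hl : l.Prime) (hp2 : p ≠ 2) (hpl : p ≠ l) (hζ : ∃ ζ : D.K, IsPrimitiveRoot ζ (4 * l))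
  (mods : ∀ M : ℕ+, D.CyclotomeMod l M)
  (f : contCocycles D.toTheta D.DeltaTheta C.GtpYdduu) (hf : f ∈ C.rootCocycles hC)
  (hmods : ∀ (M M' : ℕ+) (h : (M : ℕ) ∣ (M' : ℕ)) (x : D.lDeltaTheta l),
    MuN.red p M M' h ((mods M').red x) = (mods M).red x)
  (h15 : Literature.AnabelianGeometry.EtaleTheta.ThetaSetting.Prop15iii E hC) (L : C.CuspLabels)
  (hZ : ∀ M : ℕ+, Nonempty (ModelCyclotomes.lDeltaQuot (C.rigidData (mods M) hC hS h15 L) ≃*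
    Literature.IUT.HodgeTheaters.ZHat))

/-! ## One object, two names -/

/-- The level-`M` frames of the two landed files coincide on the nose (`ModelFamily.setting M = levelSetting M`
definitionally). [claim: Mochizuki2012, status: disputed] (IUTchII §1 Def 1.1 (i), kurims pp.20-21) -/
theorem levelFrame_eq_modelFrame (M : ℕ+) :
    levelFrame C hC hS hl hp2 hpl hζ mods f hf h15 L hZ M = modelFrame C hC hS hl hp2 hpl hζ mods f hf h15 L hZ M :=
  rfl

/-- **abc-iut-w5-d233's `naturalSystem` IS abc-iut-w4-d030's `modelSystem`**: the two landed encodings of the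
natural projective system `… → 𝕄_{M'} → 𝕄_M → …` of [EtTh] Cor. 2.19 (ii) over `ℕ_{≥1}` agree definitionally
(same members, same Def. 1.1 (i) outputs, same transitions `red_{M',M}`, same identity on `Π_X`).
[claim: Mochizuki2012, status: disputed] (IUTchII §1 Prop 1.5, kurims p.29) [cite: MochizukiEtTh2009, Cor 2.19(ii) p.64] -/
theorem naturalSystem_eq_modelSystem :
    naturalSystem C hC hS hl hp2 hpl hζ mods f hf hmods h15 L hZ =
      modelSystem C hC hS hl hp2 hpl hζ mods f hf hmods h15 L hZ :=
  rfl

/-! ## The characteristicity input of Prop. 1.5 (ii), from the named fact [EtTh] Cor. 2.18 (i) -/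

/-- **`Π^tp_{Y̲̲}` is characteristic in the topological group `Π^tp_{X̲̲}`** (`IsTopCharacteristic`, [EtTh] Def.
3.3 (i) sense), read off the FIRST CLAUSE of the named fact [EtTh] Cor. 2.18 (i) (`RigidData.Cor218_i`: every
topological automorphism of `Π^tp_X` carries `Π^tp_Y` onto itself) for abc-iut-L2-t8's rigidity data of `X̲̲_K`
at any one level `M` — exactly abc-iut-w4-d030's hypothesis `hchar` of `transitionsAreIsos_modelSystem`.
[cite: MochizukiEtTh2009, Cor 2.18(i) p.60] -/
theorem isTopCharacteristic_PiY_of_cor218_i (M : ℕ+) (h218i : (C.rigidData (mods M) hC hS h15 L).Cor218_i) :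
    Literature.AnabelianGeometry.EtaleTheta.IsTopCharacteristic ↥C.Huu (D.GtpY.subgroupOf C.Huu) :=
  fun φ => (h218i φ).1

/-! ## (b) Prop. 1.5 (ii) for the natural system, named-fact form -/

/-- **[IUTchII] Prop. 1.5 (ii) for the natural projective system of `X̲̲_K`, in NAMED-FACT currency** (abc-iut-L6-t1's
`MonoThetaProjSystem.transitionsAreIsos`, p. 29: "The transition morphisms … `Π_X(M^Θ_{M'}) → Π_X(M^Θ_M)` … are
all isomorphisms. Moreover, any isomorphism of topological groups `Π_X(M^Θ_{M'}) ⥲ Π_X(M^Θ_M)`, where `M` divides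
`M'`, lifts to a morphism of mono-theta environments `M^Θ_{M'} → M^Θ_M` [cf. [EtTh], Corollary 2.18, (iv)]"):
abc-iut-w4-d030's `transitionsAreIsos_modelSystem` with its characteristicity input supplied by [EtTh] Cor. 2.18
(i) at level `1` (`RigidData.Cor218_i`, first clause) and the lifting by [EtTh] Cor. 2.18 (iv) first half at every
level (`ThetaEnvData.Cor218_iv_surjective`). CONDITIONAL on these two named [EtTh] inputs (FACT-policy).
[claim: Mochizuki2012, status: disputed] (IUTchII §1 Prop 1.5 (ii), kurims p.29) [cite: MochizukiEtTh2009, Cor 2.18(iv) p.61] -/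
theorem transitionsAreIsos_modelSystem_of_cor218_i
    (hsurj : ∀ M : ℕ+, (levelData C hC hS mods M).Cor218_iv_surjective)
    (h218i : (C.rigidData (mods 1) hC hS h15 L).Cor218_i) :
    (modelSystem C hC hS hl hp2 hpl hζ mods f hf hmods h15 L hZ).transitionsAreIsos :=
  transitionsAreIsos_modelSystem C hC hS hl hp2 hpl hζ mods f hf hmods h15 L hZ
    (isTopCharacteristic_PiY_of_cor218_i C hC hS mods h15 L 1 h218i) hsurj

/-- The same with [EtTh] Cor. 2.18 (i) granted at an arbitrary level `M₀` (any one level suffices: the clause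
concerns `Π^tp_{Y̲̲} ⊆ Π^tp_{X̲̲}` only). [claim: Mochizuki2012, status: disputed] (IUTchII §1 Prop 1.5 (ii), kurims p.29)
[cite: MochizukiEtTh2009, Cor 2.18(i) p.60] -/
theorem transitionsAreIsos_modelSystem_of_cor218_i_at
    (hsurj : ∀ M : ℕ+, (levelData C hC hS mods M).Cor218_iv_surjective)
    (M₀ : ℕ+) (h218i : (C.rigidData (mods M₀) hC hS h15 L).Cor218_i) :
    (modelSystem C hC hS hl hp2 hpl hζ mods f hf hmods h15 L hZ).transitionsAreIsos :=
  transitionsAreIsos_modelSystem C hC hS hl hp2 hpl hζ mods f hf hmods h15 L hZ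
    (isTopCharacteristic_PiY_of_cor218_i C hC hS mods h15 L M₀ h218i) hsurj

/-! ## (a) Prop. 1.5 (i) as printed: every system is isomorphic to the natural one -/

include hmods in
/-- **[IUTchII] Prop. 1.5 (i) in the PRINTED form** ("Such a projective system is uniquely determined, up to
isomorphism, by `X̲̲_k` [cf. … the discrete rigidity property of [EtTh], Corollary 2.19, (ii)]"; [EtTh] Cor. 2.19
(ii): "any projective system … is isomorphic to the above natural projective system"): for every projective
system `B` of mono-theta environments over the model family of `X̲̲_K` whose transitions are morphisms of
mono-theta environments (`IsMonoThetaCompatible`, abc-iut-L6-t19's repaired hypothesis), the NATURAL system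
`modelSystem` and `B` are isomorphic as projective systems (abc-iut-L6-t1's `Prop15_i`: a compatible family of
isomorphisms of mono-theta environments) — abc-iut-w4-d030's conditional discharge of Prop. 1.5 (i)′
(`prop15_i'_etaleLevels`) at the pair `(modelSystem, B)`, the left member qualifying by
`isMonoThetaCompatible_modelSystem`. CONDITIONAL on exactly d030's named inputs: temp-slimness of `Π^tp_X`
(`IsSlimGroup D.PiTemp`), `IsOpenMap D.aug`, and at every level the [EtTh] Cor. 2.18 (iv) facts
`Cor218_iv_surjective`, `Cor218_iv_fibre` (FACT-policy). [claim: Mochizuki2012, status: disputed] (IUTchII §1 Prop 1.5 (i), kurims p.29)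
[cite: MochizukiEtTh2009, Cor 2.19(ii) p.64] -/
theorem prop15_i_modelSystem (hslimX : Literature.AlgebraicGeometry.Frobenioids.IsSlimGroup D.PiTemp)
    (haugOpen : IsOpenMap D.aug)
    (hsurj : ∀ M : ℕ+, (levelData C hC hS mods M).Cor218_iv_surjective)
    (hfibre : ∀ M : ℕ+, (levelData C hC hS mods M).Cor218_iv_fibre)
    (B : MonoThetaProjSystem (modelFamily C hC hS hl hp2 hpl hζ mods f hf))
    (hB : B.IsMonoThetaCompatible (reductions C hC hS hl hp2 hpl hζ mods f hf hmods hslimX)) :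
    Prop15_i (modelSystem C hC hS hl hp2 hpl hζ mods f hf hmods h15 L hZ) B :=
  prop15_i'_etaleLevels C hC hS hl hp2 hpl hζ mods f hf hmods hslimX haugOpen hsurj hfibre _ B
    (isMonoThetaCompatible_modelSystem C hC hS hl hp2 hpl hζ mods f hf hmods h15 L hZ hslimX) hB

include hmods in
/-- `prop15_i_modelSystem` with the natural system on the RIGHT (`Prop15_i B modelSystem`), for consumers that
fix their own system first. [claim: Mochizuki2012, status: disputed] (IUTchII §1 Prop 1.5 (i), kurims p.29)
[cite: MochizukiEtTh2009, Cor 2.19(ii) p.64] -/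
theorem prop15_i_modelSystem_symm (hslimX : Literature.AlgebraicGeometry.Frobenioids.IsSlimGroup D.PiTemp)
    (haugOpen : IsOpenMap D.aug)
    (hsurj : ∀ M : ℕ+, (levelData C hC hS mods M).Cor218_iv_surjective)
    (hfibre : ∀ M : ℕ+, (levelData C hC hS mods M).Cor218_iv_fibre)
    (B : MonoThetaProjSystem (modelFamily C hC hS hl hp2 hpl hζ mods f hf))
    (hB : B.IsMonoThetaCompatible (reductions C hC hS hl hp2 hpl hζ mods f hf hmods hslimX)) :
    Prop15_i B (modelSystem C hC hS hl hp2 hpl hζ mods f hf hmods h15 L hZ) :=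
  prop15_i'_etaleLevels C hC hS hl hp2 hpl hζ mods f hf hmods hslimX haugOpen hsurj hfibre B _ hB
    (isMonoThetaCompatible_modelSystem C hC hS hl hp2 hpl hζ mods f hf hmods h15 L hZ hslimX)

end EtaleLevels

end Literature.IUT.HodgeArakelov
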